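import Literature.MathematicalPhysics.QuantumFieldTheory.Balaban1983to89.T4AveragingDeficitWall
import HarnessLib

/-!
# NE7SmallFieldBootstrap — A `δ`-UNIFORM QUADRATIC BOOTSTRAP OF THE SMALL-FIELD RADIUS ITERATES TO RADIUS ZERO; radius zero means every
# plaquette variable is `1`

Cell `pub-balaban`, rung (B)+1 sub-cell t4, lineage `b2b-balaban-t4-ne7-p2`, generation 89 (CRUX PROVER NE7 #2 = co-owner of row NE7, kernel hand); file (B)
of the gen-89 line «the (APE) END along the FLAT STRATUM by the cover trick» — the generic real-analysis half of (D10), split off so that it lands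
independently of the OWNER's D8 and the END corollaries ride in (D9) `NE7ApeFlatToronEnd` ∕ (D11) `NE7ApeFlatToronCentralEnd`.
WHY.  The (APE) END at a flat datum (the OWNER's D8 `NE7ApeTrivialFlatEndCritical`, this lineage's D9 ∕ D11) is a QUADRATIC BOOTSTRAP
`SmallField U (δ∕M²) ⟹ SmallField U (K′δ²∕M²)` whose constants do not depend on `δ ≤ θ`; started at `K′δ₀ ≤ 1∕2` it ITERATES (`δ_{j+1} = K′δ_j² ≤ δ_j∕2`)
down to `SmallField U 0`, i.e. to zero curvature — so at flat data the END is a UNIQUENESS statement (the tangent-critical points of the small-field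
class are the pure gauges).  This file is the iteration, once, for every such END.
WHAT ([folklore]; 0 def, 0 sorry).  **`smallField_zero_of_bootstrap`** (a `δ`-uniform quadratic bootstrap below `θ` plus `K δ₀ ≤ 1∕2` forces radius `0`;
elementary: the iterates stay below `δ₀∕2^j`, and a norm below `c∕2^j` for every `j` is `0`), `hol_plaqWord_eq_one_of_smallField_zero` (radius `0` ⟹ every
plaquette variable is `1`).
HONEST FRAMING (page 1): elementary real analysis over the tree's `SmallField` ([B11] (4)-type small-field condition BY NAME); nothing of Bałaban's asserted;
moves no letter by itself; (APE) on the data class NOT proved; NE7 NOT PRINTED ∕ NOT PROVED; spine PROVED 0∕9; FIXED FINITE T⁴, rung (B)+1 — NOT infinite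
volume, NOT mass gap, NOT BetaPertH, NOT Clay.  Continuum YM on T⁴ ⇐ BetaPertH ∧ nine spine estimates (0/9 proved); BetaPertH ⇐ (D1) ∧ (D4) ∧ CAP+tail;
G-an2-4 gates asym, D1 and NE2/3/4.
-/

set_option autoImplicit false

open scoped BigOperators Matrix.Norms.L2Operator
open NormedSpace Finset

namespace Summit.QuantumFields.BalabanUV.T4Continuum.NE7SmallFieldBootstrap

open Literature.MathematicalPhysics.QuantumFieldTheory.Balaban1983to89
open B7Prop1Explicit B7Prop2Explicit
open T4AveragingDeficitWall (SmallField)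

noncomputable section

variable {d : ℕ} {n : Type*} [Fintype n] [DecidableEq n]

/-! ## §1 The iteration of a `δ`-uniform quadratic bootstrap -/

/-- **THE ITERATION OF A `δ`-UNIFORM QUADRATIC BOOTSTRAP FORCES RADIUS ZERO.**  If for every `0 ≤ δ ≤ θ` the small-field radius `δ∕M₂` improves to
`K·δ²∕M₂`, then a configuration of radius `δ₀∕M₂` with `δ₀ ≤ θ` and `K·δ₀ ≤ 1∕2` has radius `0`. [folklore] -/
theorem smallField_zero_of_bootstrap {U : Site d → Fin d → (Matrix n n ℂ)ˣ} {K θ M₂ : ℝ} (hK : 0 ≤ K) (hM₂ : 0 < M₂)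
    (hboot : ∀ δ : ℝ, 0 ≤ δ → δ ≤ θ → SmallField U (δ / M₂) → SmallField U (K * δ ^ 2 / M₂))
    {δ₀ : ℝ} (hδ₀ : 0 ≤ δ₀) (hδ₀θ : δ₀ ≤ θ) (hKδ₀ : K * δ₀ ≤ 1 / 2) (hU : SmallField U (δ₀ / M₂)) :
    SmallField U 0 := by
  -- the iterates `δ_{j+1} = K δ_j²`
  let seq : ℕ → ℝ := fun j => Nat.rec δ₀ (fun _ δ => K * δ ^ 2) j
  have hseq0 : seq 0 = δ₀ := rfl
  have hseqS : ∀ j, seq (j + 1) = K * seq j ^ 2 := fun _ => rfl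
  -- invariant: `0 ≤ δ_j ≤ δ₀ ∕ 2^j` and `SmallField U (δ_j ∕ M₂)`
  have hinv : ∀ j : ℕ, 0 ≤ seq j ∧ seq j ≤ δ₀ / 2 ^ j ∧ SmallField U (seq j / M₂) := by
    intro j
    induction j with
    | zero => exact ⟨by rw [hseq0]; exact hδ₀, by rw [hseq0, pow_zero, div_one], by rw [hseq0]; exact hU⟩
    | succ j ih =>
        obtain ⟨h0, hle, hS⟩ := ih
        have hleδ₀ : seq j ≤ δ₀ := hle.trans (div_le_self hδ₀ (one_le_pow₀ (by norm_num)))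
        refine ⟨by rw [hseqS]; positivity, ?_, ?_⟩
        · rw [hseqS]
          have hKs : K * seq j ≤ 1 / 2 := (mul_le_mul_of_nonneg_left hleδ₀ hK).trans hKδ₀
          calc K * seq j ^ 2 = (K * seq j) * seq j := by ring
            _ ≤ (1 / 2) * (δ₀ / 2 ^ j) := mul_le_mul hKs hle h0 (by norm_num)
            _ = δ₀ / 2 ^ (j + 1) := by rw [pow_succ]; ring
        · rw [hseqS]
          exact hboot (seq j) h0 (hleδ₀.trans hδ₀θ) hS
  -- pass to the limit plaquette by plaquette
  intro x κ κ' hκ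
  have hall : ∀ j : ℕ, ‖((hol U x (plaqWord κ κ') : (Matrix n n ℂ)ˣ) : Matrix n n ℂ) - 1‖ ≤ (δ₀ / M₂) / 2 ^ j := by
    intro j
    obtain ⟨-, hle, hS⟩ := hinv j
    have h := hS x κ κ' hκ
    calc _ ≤ seq j / M₂ := h
      _ ≤ (δ₀ / 2 ^ j) / M₂ := div_le_div_of_nonneg_right hle hM₂.le
      _ = (δ₀ / M₂) / 2 ^ j := by ring
  -- a real number below `c∕2^j` for every `j` is `≤ 0` (as the tree's `cellAbs_le_zero_of_forall_pow`, inlined)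
  by_contra ha'
  have ha : 0 < ‖((hol U x (plaqWord κ κ') : (Matrix n n ℂ)ˣ) : Matrix n n ℂ) - 1‖ := not_le.mp ha'
  obtain ⟨j, hj⟩ := pow_unbounded_of_one_lt ((δ₀ / M₂) / ‖((hol U x (plaqWord κ κ') : (Matrix n n ℂ)ˣ) : Matrix n n ℂ) - 1‖)
    (by norm_num : (1 : ℝ) < 2)
  have h1 : (δ₀ / M₂) / 2 ^ j < ‖((hol U x (plaqWord κ κ') : (Matrix n n ℂ)ˣ) : Matrix n n ℂ) - 1‖ := by
    rw [div_lt_iff₀ (by positivity : (0 : ℝ) < 2 ^ j)]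
    rw [div_lt_iff₀ ha] at hj
    linarith
  linarith [hall j]

/-! ## §2 Radius zero is zero curvature -/

/-- A configuration of small-field radius `0` has all plaquette variables equal to `1`. [folklore] -/
theorem hol_plaqWord_eq_one_of_smallField_zero {U : Site d → Fin d → (Matrix n n ℂ)ˣ} (hU0 : SmallField U 0) :
    ∀ (x : Site d) (κ μ : Fin d), κ ≠ μ → hol U x (plaqWord κ μ) = 1 := by
  intro x κ μ hκμ
  have h := hU0 x κ μ hκμ
  have h1 : ((hol U x (plaqWord κ μ) : (Matrix n n ℂ)ˣ) : Matrix n n ℂ) = 1 := by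
    rw [← sub_eq_zero]
    exact norm_le_zero_iff.mp h
  exact Units.val_eq_one.mp h1

end

end Summit.QuantumFields.BalabanUV.T4Continuum.NE7SmallFieldBootstrap
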